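import Summits.ResolutionOfSingularities.ResolutionOfSingularities.Theorems.FrobeniusLadderFInjectiveMacaulayficationRegularTower
import Summits.ResolutionOfSingularities.ResolutionOfSingularities.Theorems.FrobeniusLadderFInjectiveMacaulayficationIntrinsicTowerDimSlice
import HarnessLib

/-!
# «SING TOWERS» — ONE RECIPE, TWO STOPS: the reduced-singular-locus tower as the F-side recipe too (crux `FInjectiveMacaulayfication` stmt-ResolutionOfSingularities-15315, chain w45a;
# res-L1-w45a-plan-1 RULING R19.13 (3); res-L1-w45a-lead-1 g9; over res-L1-w45a-stub-2's `…IntrinsicTowerRecipes` (p632743) and lead-1's `…RegularTower` (p634003))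

[OURS · L1 W4.5a] Support file (`--supports stmt-ResolutionOfSingularities-15315 --as helper`); NOT a statement of any manuscript; ONE definition (the named conjecture) + door terms
CONDITIONAL on four published theorems BY NAME and on the chain's CANDIDATE tower statements; nothing of the crux is proved. AI-written (AI review is weaker than expert review).

WHY. The memoryless F-GEOMETRIC recipes died by our own computations: N_red = escalator (R19.7), rad τ = period-two cycle `L ⇄ M` (res-L1-w45a-idea-1 FB5-r7, res-L1-w45a-tri-2 replay;
occurrence on an admissible floor pending at typing time). res-L1-w45a-idea-1's diagnosis (R19.13): what loops is «centre inside the F-singular locus» (it recreates the self-similar core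
`e² + a²ce + ac²`), while blowing up the REDUCED SINGULAR LOCUS FULL-ifies the loop germ `L` in ONE step and regularises it in TWO (tri-2 engine v4.3) — exactly the T-side recipe
`RegTower.singCentre` (p634003). So ONE recipe serves BOTH halves, with two stopping predicates:
* `SingFullTowerConjecture := IntrinsicTower.Recipes.TowerTerminates RegTower.singCentre` — from every admissible Cohen–Macaulay first floor (the F-half's binders) the Sing_red tower reaches a
  floor that is FULL at every point (`RegTower.singCentre` IS a `Recipes.CentreRecipe` and `RegTower.support_singCentre_subset` IS `SingSupported singCentre` — `singSupported_singCentre`);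
* `RegTower.SingTowerConjecture p e 1` (p634003) — from every admissible FULL first floor of a FULL `e`-fold germ over `k(s)` the same tower reaches a REGULAR floor.
Door terms (all BY NAME over existing bridges): `localFInjectivizationFibreAdmGe4_of_singFullTower` (F-half ⟸ `SingFullTowerConjecture`, = p632743's `…_of_towerTerminates singCentre …`),
★ `fInjectiveMacaulayfication_of_prints_of_singTowers` (crux ⟸ four prints ∧ `SingFullTowerConjecture` ∧ ∀ p e ≥ 4 `SingTowerConjecture p e 1` — the candidate line v44 «SING TOWERS», HELD until
the K-SF table v0 (tri-2 kit j309588) is clean: publish-by-evidence rule R18.7/R19.13 (3)), and the per-dimension slices via `IntrinsicTower.DimSlice` (p634095): §3 `fInjectiveMacaulayfication_dimLe4_of_prints_of_singFullTowerAt4` (dim ≤ 4 ⟸ prints ∧ (SF)(4)) and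
`fInjectiveMacaulayfication_dimLe5_of_prints_of_singTowers45` (dim ≤ 5 ⟸ prints ∧ (SF)(4) ∧ (SF)(5) ∧ `SingTowerConjecture p 4 1`).
HONEST CAVEATS: both conjectures are CANDIDATES kernel-STRONGER than the halves they imply (v41 `Lines/step_door.lean` stays the registered skeleton); «blow up the singular locus, repeat» is
classical-looking and for that reason SUSPECT in dimension ≥ 4 (only printed termination: Zariski/Lipman, dimensionality type 1; nearest negative prior art: iterated Nash blow-ups loop on a
toric 4-fold, Castillo–Duarte–Leyton-Álvarez–Liendo 2026) — its cheapest falsifiers are running (K-RR toric scan j309536, K-SF table j309588; kernel receivers `…TowerPersistenceKit` p635381 with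
`singCentre_local`); evidence so far: E4″@G (heights 0/2, kernel p635584) and the loop germ `L` (heights 1/2, engine). FULL ⊋ F-rational; open for every d, e ≥ 4.
[folklore assembly; cite: Temkin2008, Lemma 2.1.4, Prop. 2.3.4] [cite: StacksProject, Tag 080B; Tag 02IS] [cite: CossartPiltant2019, Thm. 1.1 (i)(ii); Prop. 4.4] [cite: Cesnavicius2021, Thm. 5.3]
-/

-- single-problem summit: the doubled namespace component is forced
set_option linter.dupNamespace false

noncomputable section

open AlgebraicGeometry CategoryTheory CategoryTheory.Limits Literature.AlgebraicGeometry.Resolution TopologicalSpace IsLocalRing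

namespace Summit.ResolutionOfSingularities.ResolutionOfSingularities.Theorems.FInjectiveMacaulayfication.RegTower

open Summit.ResolutionOfSingularities.ResolutionOfSingularities.Theorems.FInjectiveMacaulayfication
open SliceableCentre IntrinsicTower IntrinsicTower.Recipes

/-! ## §1 The F-side stop of the Sing_red tower -/

/-- `RegTower.singCentre` is Sing-supported in the sense of `IntrinsicTower.Recipes.SingSupported` (same statement as `support_singCentre_subset`). [OURS] -/
theorem singSupported_singCentre : SingSupported singCentre := fun p S => support_singCentre_subset p S

/-- [OURS · CANDIDATE statement, KILLABLE — candidate F-side stub of line v44 «SING TOWERS»] **(SF) THE REDUCED-SINGULAR-LOCUS TOWER FULL-IFIES EVERY ADMISSIBLE COHEN–MACAULAY FLOOR**: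
`IntrinsicTower.Recipes.TowerTerminates RegTower.singCentre` — the F-half's binders VERBATIM, conclusion `∃ n, RecipeTowerFull singCentre p n S′`. One admissible CM floor whose Sing_red tower
never becomes FULL (loop / escalator, receiver `FullCentreDescent.not_exists_fullTower_of_recurrent_family₁` + `singCentre_local`) refutes it. Evidence at typing time: the loop germ of rad τ is
FULL after ONE Sing_red blow-up (tri-2); K-SF table v0 pending. -/
@[conjecture] def SingFullTowerConjecture : Prop := TowerTerminates singCentre

/-- **(SF) ⇒ the F-half** (`LocalFullificationFibreAdmGe4Split.LocalFInjectivizationFibreAdmGe4`), by res-L1-w45a-stub-2's recipe-parametric bridge (p632743). [OURS · conditional] -/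
theorem localFInjectivizationFibreAdmGe4_of_singFullTower (h : SingFullTowerConjecture) :
    LocalFullificationFibreAdmGe4Split.LocalFInjectivizationFibreAdmGe4 :=
  localFInjectivizationFibreAdmGe4_of_towerTerminates singCentre singSupported_singCentre h

/-! ## §2 Door terms of the candidate line v44 «SING TOWERS» (HELD; by evidence only, later) -/

/-- ★ **crux ⟸ four published theorems ∧ (SF) ∧ (RR-Sing at `r = 1`, every `e ≥ 4`)** — ONE recipe («blow up the reduced singular locus, repeat»), TWO stops (FULL for the F-half, REGULAR for the
T-half); v41's `TrFullStepDoor` term with both halves supplied through the Sing_red tower. [OURS · conditional] -/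
theorem fInjectiveMacaulayfication_of_prints_of_singTowers
    (hG : CossartPiltant2019General.{0}) (h081R : Stacks081R.{0}) (hP : CossartPiltant2019Principalization.{0})
    (hM : CesnaviciusBlowupMacaulayficationOffClosed.{0})
    (hSF : SingFullTowerConjecture)
    (hRR : ∀ p e : ℕ, p.Prime → 4 ≤ e → SingTowerConjecture p e 1) :
    Summit.ResolutionOfSingularities.ResolutionOfSingularities.Theses.FrobeniusLadder.FInjectiveMacaulayfication :=
  fInjectiveMacaulayfication_of_prints_of_tower_of_tStepOne singCentre singSupported_singCentre hG h081R hP hM hSF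
    (fun p e hp he => tStep_of_singTowerConjecture (hRR p e hp he))

/-! ## §3 Per dimension (over `IntrinsicTower.DimSlice`, p634095) -/

/-- ★ **ON SCHEMES OF DIMENSION ≤ 4: crux ⟸ four published theorems ∧ (SF) AT LEVEL 4** (`TowerTerminatesAt singCentre 4` — the Sing_red tower FULL-ifies every admissible CM floor of a
4-dimensional germ; no resolution-side residue on fourfolds). [OURS · conditional-result] [cite: Cesnavicius2021, Thm. 5.3] [cite: CossartPiltant2019, Thm. 1.1 (i)(ii); Prop. 4.4]
[cite: Temkin2008, Prop. 2.3.4] -/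
theorem fInjectiveMacaulayfication_dimLe4_of_prints_of_singFullTowerAt4
    (hG : CossartPiltant2019General.{0}) (h081R : Stacks081R.{0}) (hP : CossartPiltant2019Principalization.{0})
    (hM : CesnaviciusBlowupMacaulayficationOffClosed.{0}) (hT4 : DimSlice.TowerTerminatesAt singCentre 4) :
    ∀ p : ℕ, p.Prime → ∀ (k : Type) [Field k] [CharP k p] (X : Scheme.{0}) (f : X ⟶ Spec (.of k)),
      IsSeparated f → LocallyOfFiniteType f → QuasiCompact f → IsReduced X → topologicalKrullDim X ≤ 4 →
      ∃ (X' : Scheme.{0}) (π : X' ⟶ X), IsProper π ∧ IsBirational π ∧ ∀ x : X',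
        IsDomain (X'.presheaf.stalk x) ∧ ∀ d : ℕ, ringKrullDim (X'.presheaf.stalk x) = d →
          ∀ s : Fin d → X'.presheaf.stalk x, (Ideal.span (Set.range s)).radical.IsMaximal →
            RingTheory.Sequence.IsWeaklyRegular (X'.presheaf.stalk x) (List.ofFn s) ∧
            ∀ y : X'.presheaf.stalk x, (∃ e : ℕ, y ^ p ^ e ∈ Ideal.span
              ((fun z : X'.presheaf.stalk x => z ^ p ^ e) ''
                (Ideal.span (Set.range s) : Set (X'.presheaf.stalk x)))) →
              y ∈ Ideal.span (Set.range s) :=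
  DimSlice.fInjectiveMacaulayfication_dimLe4_of_prints_of_towerTerminatesAt4 singCentre singSupported_singCentre hG h081R hP hM hT4

/-- ★ **ON SCHEMES OF DIMENSION ≤ 5: crux ⟸ four published theorems ∧ (SF)(4) ∧ (SF)(5) ∧ `SingTowerConjecture p 4 1`** — ONE recipe at three (level, stop) pairs. [OURS · conditional-result]
[cite: Cesnavicius2021, Thm. 5.3] [cite: CossartPiltant2019, Thm. 1.1 (i)(ii); Prop. 4.4] [cite: Temkin2008, Prop. 2.3.4] -/
theorem fInjectiveMacaulayfication_dimLe5_of_prints_of_singTowers45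
    (hG : CossartPiltant2019General.{0}) (h081R : Stacks081R.{0}) (hP : CossartPiltant2019Principalization.{0})
    (hM : CesnaviciusBlowupMacaulayficationOffClosed.{0})
    (hT4 : DimSlice.TowerTerminatesAt singCentre 4) (hT5 : DimSlice.TowerTerminatesAt singCentre 5)
    (hRR41 : ∀ p : ℕ, p.Prime → SingTowerConjecture p 4 1) :
    ∀ p : ℕ, p.Prime → ∀ (k : Type) [Field k] [CharP k p] (X : Scheme.{0}) (f : X ⟶ Spec (.of k)),
      IsSeparated f → LocallyOfFiniteType f → QuasiCompact f → IsReduced X → topologicalKrullDim X ≤ 5 →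
      ∃ (X' : Scheme.{0}) (π : X' ⟶ X), IsProper π ∧ IsBirational π ∧ ∀ x : X',
        IsDomain (X'.presheaf.stalk x) ∧ ∀ d : ℕ, ringKrullDim (X'.presheaf.stalk x) = d →
          ∀ s : Fin d → X'.presheaf.stalk x, (Ideal.span (Set.range s)).radical.IsMaximal →
            RingTheory.Sequence.IsWeaklyRegular (X'.presheaf.stalk x) (List.ofFn s) ∧
            ∀ y : X'.presheaf.stalk x, (∃ e : ℕ, y ^ p ^ e ∈ Ideal.span
              ((fun z : X'.presheaf.stalk x => z ^ p ^ e) ''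
                (Ideal.span (Set.range s) : Set (X'.presheaf.stalk x)))) →
              y ∈ Ideal.span (Set.range s) :=
  DimSlice.fInjectiveMacaulayfication_dimLe5_of_prints_of_towerTerminatesAt45_of_tStep41 singCentre singSupported_singCentre hG h081R hP hM hT4 hT5
    (fun p hp => tStep_of_singTowerConjecture (hRR41 p hp))

end Summit.ResolutionOfSingularities.ResolutionOfSingularities.Theorems.FInjectiveMacaulayfication.RegTower

end
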